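import Literature.Geometry.Kaehler.ComplexTorusTranscendentalLatticeProductProjection
import Literature.Geometry.Kaehler.ComplexTorusPoincareDualForm
import Literature.Geometry.Kaehler.ComplexTorusSubtorusHodgeClass
import Literature.Geometry.Kaehler.ComplexTorusRationalHodgeStructureProduct
import HarnessLib

/-!
# The INTEGRAL Gysin image along a homomorphism of complex tori and the transcendental lattices:
# `f_! Hᵏ(X, ℤ) ⊆ H^{k′}(X′, ℤ)`, `f_! Hdg^{k,p}(X, ℤ) ⊆ Hdg^{k′,p′}(X′, ℤ)`, `f_! T^k_{l,q}(X) ⊆ T^{k′}_{l,q}(X′)`, `(gf)_! = g_! f_!`,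
# `f_! f^* = det ρ_r(f) · id`, and `(p₂)_! = ± p_{2*}`

Layer `Literature/Geometry/Kaehler`, namespace `Literature.Geometry.Kaehler.ComplexTorus`; lane `lit-hodgefound` (Track 2
foundations library), seat p09, generation 33, row g33-#4. THEOREMS ONLY (0 definitions); no named fact, net debt 0. For a homomorphism
`f = ρ(A) : X = E/Φ(ℤ^ι) → X′ = E′/Φ′(ℤ^{ι′})` (`A : ι′ × ι` integral, `ρ(A) = realRep Φ Φ′ A` `ℂ`-linear; `|ι| = n`, `|ι′| = n′`) and
degrees `l + k = n`, `l + k′ = n′`, the GYSIN IMAGE of `x ∈ Hᵏ(X, ℂ) = Altᵏ_ℝ(E; ℂ)` is the unique `x′ ∈ H^{k′}(X′, ℂ)` with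

  `⟨β, x′⟩_{e′} = ⟨f^*β, x⟩_e`   for all `β ∈ Altˡ_ℝ(E′; ℂ)`   (`⟨ , ⟩` = `poincarePairing`, `f^*β = β ∘ ρ(A)`)

(Voisin §7.3.2, PDF p. 151: "`φ_* = PD⁻¹ ∘ ᵗ(φ^*) ∘ PD`", "`(φ_*α, β)_Y = (α, φ^*β)_X`"; Arapura (5.5.1) "`∫_X f_!α ∪ β = ∫_Y α ∪ f^*β`") —
in the tree it is `poincareDualForm Φ′ e′ h′ (β ↦ ⟨f^*β, x⟩_e)` (A4-18 `ComplexTorusPoincareDualForm`). NO new definition: every statement below is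
about a form `x′` satisfying the displayed ADJUNCTION IDENTITY (hypothesis `hx′`), which §1 shows to exist uniquely. Then:

* §1 existence (`poincareDualForm`), uniqueness (perfectness), additivity.
* §2 **`f_! Hᵏ(X, ℤ) ⊆ H^{k′}(X′, ℤ)`** (Poincaré duality over `ℤ` is unimodular: `poincareDualForm_mem_integralForms`; Lange §6.2.4 p. 310
  "`Hᵖ(X, ℤ) ⥲ H^{2g−p}(X, ℤ)^*`"), and `f_! Hᵏ(X, ℚ) ⊆ H^{k′}(X′, ℚ)`.
* §3 **`f_!` has bidegree `(r, r)`**: `x` of type `(p, p)` (`p + p = k`) ⟹ `x′` of type `(p′, p′)` (`p′ + p′ = k′`) — Voisin's Lemma 7.30 argument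
  in the tree's form `isOfTypeAt_of_forall_poincarePairing_eq` (`⟨f^*β, x⟩ = 0` for `β` off type, `f^*` preserving types); hence
  **`f_! Hdg^{k,p}(X, ℤ) ⊆ Hdg^{k′,p′}(X′, ℤ)`** and `f_! B^{k,p}(X) ⊆ B^{k′,p′}(X′)`.
* §4 **`f_! T^k_{l,q}(X) ⊆ T^{k′}_{l,q}(X′)`** for the degree-`k` transcendental lattices of g31-#11 (annihilators of `Hdg^{l,q}(−, ℤ)` under
  `⟨s, ·⟩`, written out as there): `⟨s′, x′⟩ = ⟨f^*s′, x⟩ = 0` since `f^* Hdg^{l,q}(X′, ℤ) ⊆ Hdg^{l,q}(X, ℤ)` — with NO parity / type hypothesis;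
  `f_!|_T` as a `ℤ`-linear map. (The pull-back direction `f^* T(X′) ⊆ T(X)` is g33-#3 `ComplexTorusTranscendentalLatticeHomomorphisms`.)
* §5 FUNCTORIALITY: `(1_X)_! = id`, **`(g ∘ f)_! = g_! ∘ f_!`** (`ρ(B)ρ(A) = ρ(BA)`, `realRep_mul`).
* §6 **`f_! f^* y′ = det(A_{ẽ′ẽ}) · y′`** when `n = n′` (Voisin Remark 7.29 "`φ_* ∘ φ^* = d Id`"; g31-#12's `⟨f^*x, f^*y⟩ = det · ⟨x, y⟩`).
* §7 THE PROJECTION `p₂ : X₁ × X₂ → X₂`: **`(p₂)_! T = sign(e) sign(e₂) · p_{2*}T`** — the integral fibre integral `pushforwardFst` of A4-33⁺ IS the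
  Gysin image (g33-#1's adjunction `sign(e)⟨p₂^*s, T⟩_e = sign(e₂)⟨s, p_{2*}T⟩_{e₂}`; Arapura Lemma 5.5.1), so §2–§4 recover g33-#1 §2/§4.

## FAIL-DUP disclosure

The tree's `gysinMap` (`ComplexTorusGysinHodgeStructure`, `ℚ`-carriers `rationalForms`, one universe, Hodge morphism `gysinHom` under
`[HodgeTensorFacts]`) and `ComplexTorusGysinFibreIntegral` (`coe_gysinMap_sndMatrix`) are the RATIONAL siblings; the INTEGRAL statements here go
through A4-18's `poincareDualForm` / `poincareDualForm_mem_integralForms` (consumed by name, as are `eq_poincareDualForm_of_forall`,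
`isOfTypeAt_of_forall_poincarePairing_eq`, `comp_realRep_mem_integralForms/rationalForms/integralHodgeClassesIn`, `realRep_mul`, `realRep_one`,
`realRep_sndMatrix`, `poincarePairing_comp_realRep_comp_realRep`, g33-#1 `orientationSign_mul_poincarePairing_comp_snd_left`). Nothing is redefined.

## References

* [cite: VoisinHodgeI2002, §7.3.2 (PDF p. 150: Lemma 7.28, Remark 7.29 "`φ_* ∘ φ^* = d Id`"; PDF p. 151: `φ_* = PD⁻¹ ∘ ᵗ(φ^*) ∘ PD`, "`φ_*` is a morphism
  of Hodge structures of bidegree `(r, r)`", Lemma 7.30, "`(φ_*α, β)_Y = (α, φ^*β)_X`")]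
* [cite: Arapura2012, §5.5 (5.5.1) "`∫_X f_!(α) ∪ β = ∫_Y α ∪ f^*(β)`" (p. 113), §5.5.1 Lemma 5.5.1 (p. 114)]
* [cite: Lange2023AbelianVarietiesComplex, §6.2.4 (p. 310: `Hᵖ(X, ℤ) ⥲ H^{2g−p}(X, ℤ)^*`, (6.10)); §1.1.2 (p. 20); §1.7.2 Cor. 1.7.6 (proof); §7.2.2]
* [cite: Huybrechts2016K3, Ch. 3 §2.2 Def. 2.5 (PDF p. 58)]
* [cite: ShiodaMitani1974, §3 (3.19)]
-/

noncomputable section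

open Module Function
open Literature.Analysis.Complex

namespace Literature.Geometry.Kaehler.ComplexTorus

section Gysin

variable {ι ι' : Type*} [Fintype ι] [Fintype ι'] [DecidableEq ι] [DecidableEq ι']
  {E E' : Type*} [NormedAddCommGroup E] [NormedSpace ℂ E] [NormedAddCommGroup E'] [NormedSpace ℂ E']
  (Φ : (ι → ℝ) ≃L[ℝ] E) (Φ' : (ι' → ℝ) ≃L[ℝ] E') {n n' k k' l : ℕ} (e : Fin n ≃ ι) (e' : Fin n' ≃ ι') (h : l + k = n)
  (h' : l + k' = n') (A : Matrix ι' ι ℤ)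

/-! ## §1 The Gysin image: existence, uniqueness, additivity -/

/-- **Existence of the Gysin image `f_! x`**: for every `x ∈ Altᵏ_ℝ(E; ℂ)` there is `x′ ∈ Alt^{k′}_ℝ(E′; ℂ)` with `⟨β, x′⟩_{e′} = ⟨f^*β, x⟩_e` for
all `β` — the Poincaré dual form (A4-18 `poincareDualForm`) of the functional `β ↦ ⟨f^*β, x⟩_e` ("`φ_* = PD⁻¹ ∘ ᵗ(φ^*) ∘ PD`").
[cite: VoisinHodgeI2002, §7.3.2 (PDF p. 151)] [cite: Arapura2012, §5.5 (5.5.1), p. 113] -/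
theorem exists_forall_poincarePairing_eq_comp_realRep (x : E [⋀^Fin k]→L[ℝ] ℂ) :
    ∃ x' : E' [⋀^Fin k']→L[ℝ] ℂ, ∀ β : E' [⋀^Fin l]→L[ℝ] ℂ,
      poincarePairing Φ' e' h' β x' = poincarePairing Φ e h (β.compContinuousLinearMap (realRep Φ Φ' A)) x := by
  let I : Module.Dual ℂ (E' [⋀^Fin l]→L[ℝ] ℂ) :=
    { toFun := fun β ↦ poincarePairing Φ e h (β.compContinuousLinearMap (realRep Φ Φ' A)) x
      map_add' := fun β β' ↦ by
        have hadd : (β + β').compContinuousLinearMap (realRep Φ Φ' A) =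
            β.compContinuousLinearMap (realRep Φ Φ' A) + β'.compContinuousLinearMap (realRep Φ Φ' A) := by
          ext v; rfl
        rw [hadd, map_add, LinearMap.add_apply]
      map_smul' := fun c β ↦ by
        have hsmul : (c • β).compContinuousLinearMap (realRep Φ Φ' A) = c • β.compContinuousLinearMap (realRep Φ Φ' A) := by
          ext v; rfl
        rw [hsmul, map_smul, LinearMap.smul_apply, RingHom.id_apply] }
  exact ⟨poincareDualForm Φ' e' h' I, fun β ↦ poincarePairing_poincareDualForm Φ' e' h' I β⟩

/-- **Uniqueness of the Gysin image** (the pairing is perfect). [cite: VoisinHodgeI2002, §7.3.2 (PDF p. 151)] [cite: Lange2023AbelianVarietiesComplex, §6.2.4 (p. 310)] -/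
theorem eq_of_forall_poincarePairing_eq_comp_realRep {x : E [⋀^Fin k]→L[ℝ] ℂ} {x' x'' : E' [⋀^Fin k']→L[ℝ] ℂ}
    (hx' : ∀ β : E' [⋀^Fin l]→L[ℝ] ℂ,
      poincarePairing Φ' e' h' β x' = poincarePairing Φ e h (β.compContinuousLinearMap (realRep Φ Φ' A)) x)
    (hx'' : ∀ β : E' [⋀^Fin l]→L[ℝ] ℂ,
      poincarePairing Φ' e' h' β x'' = poincarePairing Φ e h (β.compContinuousLinearMap (realRep Φ Φ' A)) x) :
    x' = x'' := by
  rw [← sub_eq_zero]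
  refine eq_zero_of_forall_left_poincarePairing_eq_zero Φ' e' h' fun β ↦ ?_
  rw [map_sub, hx' β, hx'' β, sub_self]

omit [Fintype ι'] in
/-- **Additivity of the Gysin image**: `(x + y)′ = x′ + y′`. [cite: VoisinHodgeI2002, §7.3.2 (PDF p. 151)] -/
theorem forall_poincarePairing_eq_comp_realRep_add {x y : E [⋀^Fin k]→L[ℝ] ℂ} {x' y' : E' [⋀^Fin k']→L[ℝ] ℂ}
    (hx' : ∀ β : E' [⋀^Fin l]→L[ℝ] ℂ,
      poincarePairing Φ' e' h' β x' = poincarePairing Φ e h (β.compContinuousLinearMap (realRep Φ Φ' A)) x)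
    (hy' : ∀ β : E' [⋀^Fin l]→L[ℝ] ℂ,
      poincarePairing Φ' e' h' β y' = poincarePairing Φ e h (β.compContinuousLinearMap (realRep Φ Φ' A)) y)
    (β : E' [⋀^Fin l]→L[ℝ] ℂ) :
    poincarePairing Φ' e' h' β (x' + y') = poincarePairing Φ e h (β.compContinuousLinearMap (realRep Φ Φ' A)) (x + y) := by
  rw [map_add, map_add, hx' β, hy' β]

omit [Fintype ι'] in
/-- **Homogeneity of the Gysin image**: `(c · x)′ = c · x′`. [cite: VoisinHodgeI2002, §7.3.2 (PDF p. 151)] -/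
theorem forall_poincarePairing_eq_comp_realRep_smul {x : E [⋀^Fin k]→L[ℝ] ℂ} {x' : E' [⋀^Fin k']→L[ℝ] ℂ}
    (hx' : ∀ β : E' [⋀^Fin l]→L[ℝ] ℂ,
      poincarePairing Φ' e' h' β x' = poincarePairing Φ e h (β.compContinuousLinearMap (realRep Φ Φ' A)) x)
    (c : ℂ) (β : E' [⋀^Fin l]→L[ℝ] ℂ) :
    poincarePairing Φ' e' h' β (c • x') = poincarePairing Φ e h (β.compContinuousLinearMap (realRep Φ Φ' A)) (c • x) := by
  rw [map_smul, map_smul, hx' β]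

/-! ## §2 `f_! Hᵏ(X, ℤ) ⊆ H^{k′}(X′, ℤ)` (Poincaré duality over `ℤ`) and `f_! Hᵏ(X, ℚ) ⊆ H^{k′}(X′, ℚ)` -/

/-- **The Gysin image of an INTEGRAL class is integral: `f_! Hᵏ(X, ℤ) ⊆ H^{k′}(X′, ℤ)`** — the functional `β ↦ ⟨f^*β, x⟩_e` is `ℤ`-valued on
`Hˡ(X′, ℤ)` (`f^*` preserves integral classes, the cup product of integral classes is integral) and Poincaré duality `H^{k′}(X′, ℤ) ⥲ Hˡ(X′, ℤ)^*`
is an isomorphism over `ℤ` (A4-18 `poincareDualForm_mem_integralForms`). [cite: Lange2023AbelianVarietiesComplex, §6.2.4 (p. 310)] [cite: VoisinHodgeI2002, §7.3.2 (PDF p. 151: `φ_* : Hᵏ(X, ℤ) → H^{k+2r}(Y, ℤ)`)] -/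
theorem mem_integralForms_of_forall_poincarePairing_eq_comp_realRep {x : E [⋀^Fin k]→L[ℝ] ℂ} (hx : x ∈ integralForms Φ k)
    {x' : E' [⋀^Fin k']→L[ℝ] ℂ}
    (hx' : ∀ β : E' [⋀^Fin l]→L[ℝ] ℂ,
      poincarePairing Φ' e' h' β x' = poincarePairing Φ e h (β.compContinuousLinearMap (realRep Φ Φ' A)) x) :
    x' ∈ integralForms Φ' k' := by
  have heq : x' = poincareDualForm Φ' e' h' ((poincarePairing Φ' e' h').flip x') :=
    eq_poincareDualForm_of_forall Φ' e' h' _ fun β ↦ rfl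
  rw [heq]
  refine poincareDualForm_mem_integralForms Φ' e' h' _ fun γ hγ ↦ ?_
  obtain ⟨z, hz⟩ := poincarePairing_mem_range_int Φ e h (comp_realRep_mem_integralForms Φ Φ' A hγ) hx
  exact ⟨z, by rw [LinearMap.flip_apply, hx' γ, hz]⟩

/-- **`f_! Hᵏ(X, ℚ) ⊆ H^{k′}(X′, ℚ)`** (Poincaré duality over `ℚ`). [cite: VoisinHodgeI2002, §7.3.2 Lemma 7.28 / Remark 7.29 (PDF p. 150)] [cite: Lange2023AbelianVarietiesComplex, §6.2.4 (p. 310)] -/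
theorem mem_rationalForms_of_forall_poincarePairing_eq_comp_realRep {x : E [⋀^Fin k]→L[ℝ] ℂ} (hx : x ∈ rationalForms Φ k)
    {x' : E' [⋀^Fin k']→L[ℝ] ℂ}
    (hx' : ∀ β : E' [⋀^Fin l]→L[ℝ] ℂ,
      poincarePairing Φ' e' h' β x' = poincarePairing Φ e h (β.compContinuousLinearMap (realRep Φ Φ' A)) x) :
    x' ∈ rationalForms Φ' k' := by
  have heq : x' = poincareDualForm Φ' e' h' ((poincarePairing Φ' e' h').flip x') :=
    eq_poincareDualForm_of_forall Φ' e' h' _ fun β ↦ rfl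
  rw [heq]
  refine poincareDualForm_mem_rationalForms Φ' e' h' _ fun γ hγ ↦ ?_
  obtain ⟨q, hq⟩ := poincarePairing_mem_range_rat Φ e h (comp_realRep_mem_rationalForms Φ Φ' A hγ) hx
  exact ⟨q, by rw [LinearMap.flip_apply, hx' γ, hq]⟩

/-! ## §3 `f_!` has bidegree `(r, r)`: `f_! Hdg^{k,p}(X, ℤ) ⊆ Hdg^{k′,p′}(X′, ℤ)` -/

/-- **The Gysin image of a `(p, p)`-form is a `(p′, p′)`-form** (`p + p = k`, `p′ + p′ = k′`; "`φ_*` is a morphism of Hodge structures of bidegree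
`(r, r)`", `r = p′ − p`): by Lemma 7.30 (tree: `isOfTypeAt_of_forall_poincarePairing_eq`) it suffices that `⟨f^*β, x⟩ = 0` for `β` of type `(r, s)`,
`r ≠ s` — and indeed `f^*β ∧ x` is then a top-degree form of type `(r + p, s + p) ≠ (g, g)`, hence zero.
[cite: VoisinHodgeI2002, §7.3.2 (PDF p. 151: Lemma 7.30 and the bidegree of `φ_*`)] -/
theorem isOfTypeAt_of_forall_poincarePairing_eq_comp_realRep (hA : ∀ (c : ℂ) (u : E), realRep Φ Φ' A (c • u) = c • realRep Φ Φ' A u)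
    {p p' : ℕ} (hk : p + p = k) (hk' : p' + p' = k') {x : E [⋀^Fin k]→L[ℝ] ℂ} (hx : IsOfTypeAt p p x) {x' : E' [⋀^Fin k']→L[ℝ] ℂ}
    (hx' : ∀ β : E' [⋀^Fin l]→L[ℝ] ℂ,
      poincarePairing Φ' e' h' β x' = poincarePairing Φ e h (β.compContinuousLinearMap (realRep Φ Φ' A)) x) :
    IsOfTypeAt p' p' x' := by
  haveI := finiteDimensional_real Φ' e'
  haveI : FiniteDimensional ℂ E' := Module.Finite.of_restrictScalars_finite ℝ ℂ E'
  haveI := finiteDimensional_real Φ e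
  haveI : FiniteDimensional ℂ E := Module.Finite.of_restrictScalars_finite ℝ ℂ E
  have hn : n = Fintype.card ι := by simpa using Fintype.card_congr e
  have hgg : finrank ℂ E + finrank ℂ E = l + k := by rw [finrank_add_finrank_eq_card Φ]; omega
  refine isOfTypeAt_of_forall_poincarePairing_eq Φ' e' h' hk'
    (fun β ↦ poincarePairing Φ e h (β.compContinuousLinearMap (realRep Φ Φ' A)) x) (fun β r s hβ hrs ↦ ?_) hx'
  have hβ' : IsOfTypeAt r s (β.compContinuousLinearMap (realRep Φ Φ' A)) := hβ.compContinuousLinearMap _ hA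
  have hw : IsOfTypeAt (r + p) (s + p) ((β.compContinuousLinearMap (realRep Φ Φ' A)).wedge x) := hβ'.wedge hx
  have h0 := eq_zero_of_isOfTypeAt_of_ne_top hw hgg (by omega)
  simp only [poincarePairing_apply, h0, ContinuousAlternatingMap.coe_zero, Pi.zero_apply]

/-- **`f_! Hdg^{k,p}(X, ℤ) ⊆ Hdg^{k′,p′}(X′, ℤ)`**: the Gysin image of an integral Hodge class is an integral Hodge class (§2 + the bidegree).
[cite: VoisinHodgeI2002, §7.3.2 (PDF p. 151) and §11.3.1 Def. 11.28] [cite: Lange2023AbelianVarietiesComplex, §7.2.2] -/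
theorem mem_integralHodgeClassesIn_of_forall_poincarePairing_eq_comp_realRep
    (hA : ∀ (c : ℂ) (u : E), realRep Φ Φ' A (c • u) = c • realRep Φ Φ' A u) {p p' : ℕ} (hk : p + p = k) (hk' : p' + p' = k')
    {x : E [⋀^Fin k]→L[ℝ] ℂ} (hx : x ∈ integralHodgeClassesIn Φ k p) {x' : E' [⋀^Fin k']→L[ℝ] ℂ}
    (hx' : ∀ β : E' [⋀^Fin l]→L[ℝ] ℂ,
      poincarePairing Φ' e' h' β x' = poincarePairing Φ e h (β.compContinuousLinearMap (realRep Φ Φ' A)) x) :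
    x' ∈ integralHodgeClassesIn Φ' k' p' := by
  have hx1 := (mem_integralHodgeClassesIn_iff Φ).1 hx
  exact (mem_integralHodgeClassesIn_iff Φ').2
    ⟨mem_integralForms_of_forall_poincarePairing_eq_comp_realRep Φ Φ' e e' h h' A hx1.1 hx',
      (isOfTypeAt_of_forall_poincarePairing_eq_comp_realRep Φ Φ' e e' h h' A hA hk hk'
        ((mem_typeSubmodule_iff_isOfTypeAt hk).1 hx1.2) hx').mem_typeSubmodule⟩

/-- **`f_! B^{k,p}(X) ⊆ B^{k′,p′}(X′)`**: the Gysin image of a rational Hodge class is a rational Hodge class.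
[cite: VoisinHodgeI2002, §7.3.2 (PDF p. 151)] [cite: Lange2023AbelianVarietiesComplex, §7.2.2] -/
theorem mem_hodgeClassesIn_of_forall_poincarePairing_eq_comp_realRep
    (hA : ∀ (c : ℂ) (u : E), realRep Φ Φ' A (c • u) = c • realRep Φ Φ' A u) {p p' : ℕ} (hk : p + p = k) (hk' : p' + p' = k')
    {x : E [⋀^Fin k]→L[ℝ] ℂ} (hx : x ∈ hodgeClassesIn Φ k p) {x' : E' [⋀^Fin k']→L[ℝ] ℂ}
    (hx' : ∀ β : E' [⋀^Fin l]→L[ℝ] ℂ,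
      poincarePairing Φ' e' h' β x' = poincarePairing Φ e h (β.compContinuousLinearMap (realRep Φ Φ' A)) x) :
    x' ∈ hodgeClassesIn Φ' k' p' := by
  have hx1 := (mem_hodgeClassesIn_iff_isOfTypeAt Φ hk).1 hx
  exact (mem_hodgeClassesIn_iff_isOfTypeAt Φ' hk').2
    ⟨mem_rationalForms_of_forall_poincarePairing_eq_comp_realRep Φ Φ' e e' h h' A hx1.1 hx',
      isOfTypeAt_of_forall_poincarePairing_eq_comp_realRep Φ Φ' e e' h h' A hA hk hk' hx1.2 hx'⟩

/-! ## §4 `f_! T^k_{l,q}(X) ⊆ T^{k′}_{l,q}(X′)` -/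

/-- **`f_! T^k_{l,q}(X) ⊆ T^{k′}_{l,q}(X′)`**: if `x ∈ Hᵏ(X, ℤ)` annihilates `Hdg^{l,q}(X, ℤ)` then its Gysin image `x′ ∈ H^{k′}(X′, ℤ)` annihilates
`Hdg^{l,q}(X′, ℤ)` — `⟨s′, x′⟩_{e′} = ⟨f^*s′, x⟩_e = 0` because `f^* Hdg^{l,q}(X′, ℤ) ⊆ Hdg^{l,q}(X, ℤ)` (g31-#6 `comp_realRep_mem_integralHodgeClassesIn`).
The Gysin morphism respects the transcendental lattices (no parity hypothesis needed).
[cite: VoisinHodgeI2002, §7.3.2 (PDF p. 151: "`(φ_*α, β)_Y = (α, φ^*β)_X`")] [cite: Huybrechts2016K3, Ch. 3 §2.2 Def. 2.5 (PDF p. 58)] -/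
theorem mem_integralHodgeAnnihilator_of_forall_poincarePairing_eq_comp_realRep
    (hA : ∀ (c : ℂ) (u : E), realRep Φ Φ' A (c • u) = c • realRep Φ Φ' A u) (q : ℕ) {x : E [⋀^Fin k]→L[ℝ] ℂ}
    (hx : x ∈ integralForms Φ k ⊓ ⨅ s : integralHodgeClassesIn Φ l q,
        (LinearMap.ker (poincarePairing Φ e h (s : E [⋀^Fin l]→L[ℝ] ℂ))).toAddSubgroup)
    {x' : E' [⋀^Fin k']→L[ℝ] ℂ}
    (hx' : ∀ β : E' [⋀^Fin l]→L[ℝ] ℂ,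
      poincarePairing Φ' e' h' β x' = poincarePairing Φ e h (β.compContinuousLinearMap (realRep Φ Φ' A)) x) :
    x' ∈ integralForms Φ' k' ⊓ ⨅ s : integralHodgeClassesIn Φ' l q,
        (LinearMap.ker (poincarePairing Φ' e' h' (s : E' [⋀^Fin l]→L[ℝ] ℂ))).toAddSubgroup := by
  rw [mem_integralHodgeAnnihilator_iff] at hx ⊢
  refine ⟨mem_integralForms_of_forall_poincarePairing_eq_comp_realRep Φ Φ' e e' h h' A hx.1 hx', fun s hs ↦ ?_⟩
  rw [hx' s]
  exact hx.2 _ (comp_realRep_mem_integralHodgeClassesIn Φ Φ' A hA hs)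

/-- **`f_!|_T : T^k_{l,q}(X) → T^{k′}_{l,q}(X′)` as a `ℤ`-linear map** (the Gysin image depends additively on `x`).
[cite: VoisinHodgeI2002, §7.3.2 (PDF p. 151)] -/
theorem exists_intLinearMap_integralHodgeAnnihilator_gysin
    (hA : ∀ (c : ℂ) (u : E), realRep Φ Φ' A (c • u) = c • realRep Φ Φ' A u) (q : ℕ) :
    ∃ G : ↥(integralForms Φ k ⊓ ⨅ s : integralHodgeClassesIn Φ l q,
          (LinearMap.ker (poincarePairing Φ e h (s : E [⋀^Fin l]→L[ℝ] ℂ))).toAddSubgroup) →ₗ[ℤ]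
        ↥(integralForms Φ' k' ⊓ ⨅ s : integralHodgeClassesIn Φ' l q,
          (LinearMap.ker (poincarePairing Φ' e' h' (s : E' [⋀^Fin l]→L[ℝ] ℂ))).toAddSubgroup),
      ∀ x (β : E' [⋀^Fin l]→L[ℝ] ℂ), poincarePairing Φ' e' h' β (G x : E' [⋀^Fin k']→L[ℝ] ℂ) =
        poincarePairing Φ e h (β.compContinuousLinearMap (realRep Φ Φ' A)) (x : E [⋀^Fin k]→L[ℝ] ℂ) := by
  choose F hF using fun x : E [⋀^Fin k]→L[ℝ] ℂ ↦ exists_forall_poincarePairing_eq_comp_realRep Φ Φ' e e' h h' A x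
  have hadd : ∀ x y, F (x + y) = F x + F y := fun x y ↦
    eq_of_forall_poincarePairing_eq_comp_realRep Φ Φ' e e' h h' A (hF (x + y))
      (forall_poincarePairing_eq_comp_realRep_add Φ Φ' e e' h h' A (hF x) (hF y))
  let G : ↥(integralForms Φ k ⊓ ⨅ s : integralHodgeClassesIn Φ l q,
          (LinearMap.ker (poincarePairing Φ e h (s : E [⋀^Fin l]→L[ℝ] ℂ))).toAddSubgroup) →ₗ[ℤ]
        ↥(integralForms Φ' k' ⊓ ⨅ s : integralHodgeClassesIn Φ' l q,
          (LinearMap.ker (poincarePairing Φ' e' h' (s : E' [⋀^Fin l]→L[ℝ] ℂ))).toAddSubgroup) :=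
    (AddMonoidHom.mk' (fun x ↦ ⟨F (x : E [⋀^Fin k]→L[ℝ] ℂ),
      mem_integralHodgeAnnihilator_of_forall_poincarePairing_eq_comp_realRep Φ Φ' e e' h h' A hA q x.2 (hF _)⟩)
      fun x y ↦ Subtype.ext (by simp only [AddSubgroup.coe_add]; exact hadd _ _)).toIntLinearMap
  have hG : ∀ x, (G x : E' [⋀^Fin k']→L[ℝ] ℂ) = F (x : E [⋀^Fin k]→L[ℝ] ℂ) := fun _ ↦ rfl
  exact ⟨G, fun x β ↦ by rw [hG]; exact hF _ β⟩

/-! ## §5 Functoriality: `(1_X)_! = id`, `(g ∘ f)_! = g_! ∘ f_!` -/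

omit [Fintype ι'] [DecidableEq ι'] in
/-- **`(1_X)_! = id`**: `x` is its own Gysin image along `ρ(1) = id`. [cite: VoisinHodgeI2002, §7.3.2 (PDF p. 151)] [cite: Lange2023AbelianVarietiesComplex, §1.1.2 (p. 20)] -/
theorem forall_poincarePairing_eq_comp_realRep_one (x : E [⋀^Fin k]→L[ℝ] ℂ) (β : E [⋀^Fin l]→L[ℝ] ℂ) :
    poincarePairing Φ e h β x = poincarePairing Φ e h (β.compContinuousLinearMap (realRep Φ Φ (1 : Matrix ι ι ℤ))) x := by
  rw [realRep_one]
  rfl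

/-- **`(g ∘ f)_! = g_! ∘ f_!`**: if `x′` is the Gysin image of `x` along `f = ρ(A) : X → X′` and `x″` that of `x′` along `g = ρ(B) : X′ → X″`, then `x″`
is the Gysin image of `x` along `g ∘ f = ρ(BA)` (`(g ∘ f)^* = f^* ∘ g^*`, `realRep_mul`). [cite: VoisinHodgeI2002, §7.3.2 (PDF p. 151)] [cite: Lange2023AbelianVarietiesComplex, §1.1.2 (p. 20)] -/
theorem forall_poincarePairing_eq_comp_realRep_mul {ι'' E'' : Type*} [DecidableEq ι''] [NormedAddCommGroup E''] [NormedSpace ℂ E'']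
    (Φ'' : (ι'' → ℝ) ≃L[ℝ] E'') {n'' k'' : ℕ} (e'' : Fin n'' ≃ ι'') (h'' : l + k'' = n'') (B : Matrix ι'' ι' ℤ)
    {x : E [⋀^Fin k]→L[ℝ] ℂ} {x' : E' [⋀^Fin k']→L[ℝ] ℂ} {x'' : E'' [⋀^Fin k'']→L[ℝ] ℂ}
    (hx' : ∀ β : E' [⋀^Fin l]→L[ℝ] ℂ,
      poincarePairing Φ' e' h' β x' = poincarePairing Φ e h (β.compContinuousLinearMap (realRep Φ Φ' A)) x)
    (hx'' : ∀ γ : E'' [⋀^Fin l]→L[ℝ] ℂ,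
      poincarePairing Φ'' e'' h'' γ x'' = poincarePairing Φ' e' h' (γ.compContinuousLinearMap (realRep Φ' Φ'' B)) x')
    (γ : E'' [⋀^Fin l]→L[ℝ] ℂ) :
    poincarePairing Φ'' e'' h'' γ x'' = poincarePairing Φ e h (γ.compContinuousLinearMap (realRep Φ Φ'' (B * A))) x := by
  rw [hx'' γ, hx']
  have hc : (γ.compContinuousLinearMap (realRep Φ' Φ'' B)).compContinuousLinearMap (realRep Φ Φ' A) =
      γ.compContinuousLinearMap ((realRep Φ' Φ'' B).comp (realRep Φ Φ' A)) := by
    ext v; rfl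
  rw [hc, realRep_mul]

/-! ## §6 `f_! f^* = det ρ_r(f) · id` in equal dimensions -/

/-- **`f_! f^* y′ = det(A_{ẽ′ẽ}) · y′`** for a homomorphism `f = ρ(A) : X → X′` between tori with lattices of the same rank (`n = n′`; Voisin
Remark 7.29 "`φ_* ∘ φ^* = d Id`" with `d = deg φ`; for tori `⟨f^*β, f^*y′⟩_e = det(A_{ẽ′ẽ}) ⟨β, y′⟩_{e′}`, g31-#12
`poincarePairing_comp_realRep_comp_realRep`). [cite: VoisinHodgeI2002, §7.3.2 Remark 7.29 (PDF p. 150)] [cite: Lange2023AbelianVarietiesComplex, §1.7.2 Cor. 1.7.6 (proof)] -/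
theorem eq_det_smul_of_forall_poincarePairing_eq_comp_realRep {m : ℕ} (e₁ : Fin m ≃ ι) (e₁' : Fin m ≃ ι') (hm : l + k = m)
    (y' : E' [⋀^Fin k]→L[ℝ] ℂ) {x' : E' [⋀^Fin k]→L[ℝ] ℂ}
    (hx' : ∀ β : E' [⋀^Fin l]→L[ℝ] ℂ, poincarePairing Φ' e₁' hm β x' =
      poincarePairing Φ e₁ hm (β.compContinuousLinearMap (realRep Φ Φ' A)) (y'.compContinuousLinearMap (realRep Φ Φ' A))) :
    x' = ((A.submatrix ((finCongr hm).trans e₁') ((finCongr hm).trans e₁)).det : ℂ) • y' := by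
  rw [← sub_eq_zero]
  refine eq_zero_of_forall_left_poincarePairing_eq_zero Φ' e₁' hm fun β ↦ ?_
  rw [map_sub, hx' β, poincarePairing_comp_realRep_comp_realRep Φ Φ' e₁ e₁' hm A β y', map_smul, smul_eq_mul, sub_self]

/-! ## §7 The projection `p₂ : X₁ × X₂ → X₂`: `(p₂)_! = sign(e) sign(e₂) · p_{2*}` -/

/-- **The fibre integral IS the Gysin image: `(p₂)_! T = sign(e) sign(e₂) · p_{2*}T`** for `T ∈ H^{N₁+l′}(X₁ × X₂)` (A4-33⁺ `pushforwardFst`, any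
enumerations `e` of `Λ₁ ⊕ Λ₂` and `e₂` of `Λ₂`; `p₂ = ρ(sndMatrix)`, `realRep_sndMatrix`): `⟨s, sign(e)sign(e₂) p_{2*}T⟩_{e₂} = ⟨p₂^*s, T⟩_e` by
g33-#1's adjunction — Arapura's Lemma 5.5.1 "`p_!α` is represented by `∫_p α`" on integral cohomology, up to the orientation signs of the chosen
enumerations. [cite: Arapura2012, §5.5.1 Lemma 5.5.1, p. 114] [cite: Lange2023AbelianVarietiesComplex, §6.2.4 (6.10) p. 310] -/
theorem forall_poincarePairing_smul_pushforwardFst_eq_comp_realRep_sndMatrix {ι₁ ι₂ : Type*} [Fintype ι₁] [Fintype ι₂]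
    [DecidableEq ι₁] [DecidableEq ι₂] {E₁ E₂ : Type*} [NormedAddCommGroup E₁] [NormedSpace ℂ E₁] [NormedAddCommGroup E₂]
    [NormedSpace ℂ E₂] (Φ₁ : (ι₁ → ℝ) ≃L[ℝ] E₁) (Φ₂ : (ι₂ → ℝ) ≃L[ℝ] E₂) {N₁ a l' : ℕ} (e₁ : Fin N₁ ≃ ι₁)
    (e₂ : Fin (a + l') ≃ ι₂) (e₀ : Fin (a + (N₁ + l')) ≃ ι₁ ⊕ ι₂) (T : (E₁ × E₂) [⋀^Fin (N₁ + l')]→L[ℝ] ℂ)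
    (s : E₂ [⋀^Fin a]→L[ℝ] ℂ) :
    poincarePairing Φ₂ e₂ rfl s
        (((orientationSign (prodPeriod Φ₁ Φ₂) e₀ : ℂ) * (orientationSign Φ₂ e₂ : ℂ)) • pushforwardFst Φ₁ Φ₂ e₁ T) =
      poincarePairing (prodPeriod Φ₁ Φ₂) e₀ rfl
        (s.compContinuousLinearMap (realRep (prodPeriod Φ₁ Φ₂) Φ₂ (sndMatrix ι₁ ι₂))) T := by
  have hadj := orientationSign_mul_poincarePairing_comp_snd_left Φ₁ Φ₂ e₁ e₂ e₀ s T
  have h0 : (orientationSign (prodPeriod Φ₁ Φ₂) e₀ : ℂ) * (orientationSign (prodPeriod Φ₁ Φ₂) e₀ : ℂ) = 1 := by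
    exact_mod_cast orientationSign_mul_self (prodPeriod Φ₁ Φ₂) e₀
  rw [realRep_sndMatrix, map_smul, smul_eq_mul]
  linear_combination
    (poincarePairing (prodPeriod Φ₁ Φ₂) e₀ rfl (s.compContinuousLinearMap (ContinuousLinearMap.snd ℝ E₁ E₂)) T) * h0 -
    (orientationSign (prodPeriod Φ₁ Φ₂) e₀ : ℂ) * hadj

end Gysin

end Literature.Geometry.Kaehler.ComplexTorus
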